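/-
Copyright: lit-balaban Phase-2 proof seat p09 (gen 9).  Statement-level skeleton of a published paper; no proof claims beyond what
the kernel checks below.
-/
import Literature.MathematicalPhysics.QuantumFieldTheory.BalabanImbrieJaffe1984to88.BIJ85CurlyDkDecayTorus
import Literature.MathematicalPhysics.QuantumFieldTheory.BalabanImbrieJaffe1984to88.BIJ85Ineq732SecondForm
import Literature.MathematicalPhysics.QuantumFieldTheory.BalabanImbrieJaffe1984to88.BIJ88Eq541Base0

/-!
# [BalabanImbrieJaffe1985] (4.5.4) p. 313 / §7.3 p. 326: the unit-bond LINE SUMS of the correction `T_kg = 𝒟_k∂*Q^{e*}_kg` written through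
the kernels of `H_j` and `C^{(j)}` ((4.4.4)) — the two exact identities on which a kernel-bound estimate of p11's located constant `K_T`
(`BIJ85Claim73SecondForm.SecClosedIdx.hT`) rests

T. Bałaban, J. Imbrie, A. Jaffe, *Renormalization of the Higgs model: minimizers, propagators and the stability of mean field theory*,
Commun. Math. Phys. **97** (1985) 299–329 [BalabanImbrieJaffe1985]; [BalabanImbrieJaffe1988] = Commun. Math. Phys. **114** (1988) 257–315,
(5.4.1) p. 281 (the operator `T_k`).  Rows **C1.Eq4.4.4**, **C1.Eq7.3.1-7.3.2** (second printed form of (7.3.2)) of the lit-balaban skeleton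
(owner r15, referee ref-5); GAPS G-C1-05 ADDENDUM 7 (p09 gen 9) names the estimate these identities serve.

THE PRINTED TEXT, verbatim.  p. 312 [PDF 14]: *"Let 𝒟_k = Σ_{j=0}^{k−1} H_jC^{(j)}H_j*. (4.4.4)"*; p. 313 [PDF 15]: *"Now we define
(u_k)_b = (Q^{s*}_kv)_b exp[−ie_kη(𝒟_k∂*Q^{e*}_kf^{(k)})_b]. (4.5.4)"*; p. 313, (5.1.2): *"Γ_{x_{j+1},x_j}"* — the straight contours of
`L` bonds of `T^{(j)}` from a block corner (p11's `lineSumU`/`lineSumIter`: the sum of an η-bond function over the `L^k` η-bonds of the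
straight unit-lattice bond from the lowest corner); p. 326 [PDF 28]: *"The second form of the inequality substitutes v_b for u_k(b)"*.

WHAT THIS FILE PROVES (0 `sorry`, theorems only — proof lane; every `d ≥ 2`, every torus of `Balaban1983to89.Setup`, standing range):
* §1 runs and corners: `runSite_runSite` (`(x + ae_μ) + te_μ = x + (a+t)e_μ`), `corner_runSite` (the corner of the block `y + se_μ` is the
  corner of `y` moved by `sL` fine steps), `cornerIter_runSite` (k-fold: `s·L^k` steps).
* §2 **`lineSumIter_eq_sum_runBond`** — p11's recursive line sum IS the straight run: for `j + k ≤ m + K`,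
  `lineSumIter θ k c = Σ_{t<L^k} θ(⟨x₀ + te_μ, μ⟩)`, `x₀ = cornerIter k c₋` the lowest corner, `μ = c.dir`.
* §3 **`TkF_eq_sum_single`** (linearity in the unit-lattice plaquette function: `(T_kg)(b) = Σ_p g(p)·(T_ke_p)(b)`) and
  **`TkF_single_eq_sum`** — (4.4.4) entrywise for the correction: `(T_ke_p)(b) = Σ_{j<k} Σ_{b₁,b₂∈T^{(j)}} H_j(b,b₁)·C^{(j)}(b₁,b₂)·u^{(j)}_p(b₂)`
  with `H_j(b,b₁) = (H_je_{b₁})(b)` (p11's `HkE`), `C^{(j)}(b₁,b₂) = ⟨e_{b₁}, C^{(j)}e_{b₂}⟩` (p11's `CE`) and `u^{(j)}_p = H_j*∂*Q^{e*}_ke_p` (whose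
  coordinates are p08's `BIJ88SigmaKernelDkTorus.adjoint_HkE_coord`: edge averages of the columns `∂^cH_je_b`); **`TkF_eq_triple_sum`** = both.
HONEST SCOPE.  Exact algebraic/combinatorial identities only; no estimate.  They reduce `η·Σ_{line(c)}(T_kg)` to Σ_p g(p) Σ_{t<L^k} Σ_{j<k}
Σ_{b₁,b₂} H_j(⟨x₀+te_μ, μ⟩, b₁)C^{(j)}(b₁,b₂)u^{(j)}_p(b₂), to which the sup/gradient members of (7.2.2) and (7.2.3) apply scale by scale
(p08's `BIJ85CurlyDkGradTorus.abs_gradTermDk_le`, `BIJ88Decay216Torus.abs_curl_col_le`, `triple_sum_le`) — the estimate itself is NOT here.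

statement-level skeleton of published theorems with citation tags; proofs where landed; nothing here is a claim about the Yang–Mills mass gap
-/

open scoped BigOperators RealInnerProductSpace
open Finset

namespace Literature.MathematicalPhysics.QuantumFieldTheory.BalabanImbrieJaffe1984to88.BIJ85LineSumTkKernel

open Balaban1983to89 hiding Site Plaq
open Balaban1983to89.LatticeFieldCalculus hiding runSite runBond runSite_zero
open BIJ85AxialPropagator411 (BondSpace toE curlOp)
open BIJ85Prop521Torus (CoarseSpace toEj)
open BIJ85Prop522Torus (HkE CE DkE)
open BIJ85Sigma421Torus (UnitPlaqSpace toU QesOp)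
open BIJ88Eq541Base0 (TkF TkF_apply)
open BIJ85BlockAveragesTorus (corner val_corner runSite runBond runSite_zero)
open BIJ85BlockAveragesTorusK (cornerIter cornerIter_zero cornerIter_succ)
open BIJ85Ineq732SecondForm (lineSumU lineSumIter lineSumIter_zero lineSumIter_succ)
open BIJ88SigmaKernelDkTorus (inner_DkE_eq_sum)
open BIJ85CurlyDkDecayTorus (adjoint_HkE_single_apply)
open Balaban1983to89 renaming Site → TSite, Plaq → TPlaq

noncomputable section

variable {P : Params}

/-! ## §1  Runs and corners -/

/-- kernel: `(x + ae_μ) + te_μ = x + (a + t)e_μ`. [cite: BalabanImbrieJaffe1985, (2.10) p.303] -/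
theorem runSite_runSite {j : ℕ} (x : TSite P j) (μ : Fin P.d) (a t : ℕ) : runSite (runSite x μ a) μ t = runSite x μ (a + t) := by
  funext κ
  by_cases hκ : κ = μ
  · subst hκ
    simp only [runSite, Function.update_self]
    push_cast
    ring
  · simp only [runSite, Function.update_of_ne hκ]

/-- kernel: the run bonds of a shifted run. [cite: BalabanImbrieJaffe1985, (2.10) p.303] -/
theorem runBond_runSite {j : ℕ} (x : TSite P j) (μ : Fin P.d) (a t : ℕ) : runBond (runSite x μ a) μ t = runBond x μ (a + t) := by
  rw [runBond, runBond, runSite_runSite]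

/-- kernel: reducing a label modulo the coarse period before multiplying by `L` does not change it modulo the fine period
(`|T^{(j)}| = L·|T^{(j+1)}|` per direction). [cite: BalabanImbrieJaffe1985, (2.4) p.302] -/
private theorem natCast_mod_mul_L {j : ℕ} (hj : j + 1 ≤ P.m + P.K) (a : ℕ) :
    (((a % P.sitesPerDir (j + 1)) * P.L : ℕ) : ZMod (P.sitesPerDir j)) = ((a * P.L : ℕ) : ZMod (P.sitesPerDir j)) := by
  set n' := P.sitesPerDir (j + 1) with hn'
  have hdecomp : a * P.L = (a % n') * P.L + (a / n') * (n' * P.L) := by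
    have h := Nat.mod_add_div a n'
    calc a * P.L = (a % n' + n' * (a / n')) * P.L := by rw [h]
      _ = (a % n') * P.L + (a / n') * (n' * P.L) := by ring
  have hzero : ((n' * P.L : ℕ) : ZMod (P.sitesPerDir j)) = 0 := by
    rw [ZMod.natCast_eq_zero_iff, P.sitesPerDir_eq_mul_succ hj]
  rw [hdecomp, Nat.cast_add, Nat.cast_mul (a / n'), hzero, mul_zero, add_zero]

/-- **the corner of a translated block**: `corner(y + se_μ) = corner(y) + sL·e_μ` (standing range `j + 1 ≤ m + K`).
[cite: BalabanImbrieJaffe1985, (2.4) p.302] -/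
theorem corner_runSite {j : ℕ} (hj : j + 1 ≤ P.m + P.K) (y : TSite P (j + 1)) (μ : Fin P.d) (s : ℕ) :
    corner (runSite y μ s) = runSite (corner y) μ (s * P.L) := by
  funext κ
  by_cases hκ : κ = μ
  · subst hκ
    -- both sides as casts of natural numbers
    have hL : corner (runSite y κ s) κ = ((((runSite y κ s) κ).val * P.L + ((0 : Fin P.L) : ℕ) : ℕ) : ZMod (P.sitesPerDir j)) := rfl
    have hR0 : corner y κ = ((((y κ).val * P.L + ((0 : Fin P.L) : ℕ) : ℕ)) : ZMod (P.sitesPerDir j)) := rfl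
    rw [hL]
    simp only [runSite, Function.update_self]
    rw [hR0]
    simp only [Fin.val_zero, add_zero]
    rw [ZMod.val_add, ZMod.val_natCast, Nat.add_mod_mod, natCast_mod_mul_L hj, Nat.add_mul]
    push_cast
    ring
  · simp only [runSite, Function.update_of_ne hκ]
    show Balaban1983to89.Site.blockSite (Function.update y μ (y μ + s)) _ κ = _
    simp only [Balaban1983to89.Site.blockSite, Function.update_of_ne hκ]
    rfl

/-- **k-fold**: `cornerIter k (y + se_μ) = cornerIter k y + sL^k·e_μ` (`j + k ≤ m + K`). [cite: BalabanImbrieJaffe1985, (5.1.2) p.313] -/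
theorem cornerIter_runSite {j : ℕ} : ∀ (k : ℕ), j + k ≤ P.m + P.K → ∀ (y : TSite P (j + k)) (μ : Fin P.d) (s : ℕ),
    cornerIter k (runSite y μ s) = runSite (cornerIter k y) μ (s * P.L ^ k)
  | 0, _, y, μ, s => by simp
  | k + 1, hk, y, μ, s => by
    rw [cornerIter_succ, cornerIter_succ, corner_runSite (by omega) y μ s, cornerIter_runSite k (by omega), pow_succ, ← mul_assoc,
      mul_right_comm]

/-! ## §2  p11's recursive line sum is the straight run of `L^k` bonds from the lowest corner -/

/-- kernel: `Σ_{u<ab} f(u) = Σ_{s<a} Σ_{t<b} f(sb + t)`. [folklore] -/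
private theorem sum_range_mul (f : ℕ → ℝ) (b : ℕ) : ∀ a : ℕ,
    ∑ u ∈ range (a * b), f u = ∑ s ∈ range a, ∑ t ∈ range b, f (s * b + t)
  | 0 => by simp
  | a + 1 => by
    rw [Nat.succ_mul, Finset.sum_range_add, sum_range_mul f b a, Finset.sum_range_succ]

/-- kernel: a bond is its source and direction. [cite: BalabanImbrieJaffe1985, (2.10) p.303] -/
private theorem runBond_src_dir_zero {j : ℕ} (c : PBond P j) : runBond c.src c.dir 0 = c := by
  rw [runBond, runSite_zero]

/-- **`lineSumIter θ k c = Σ_{t<L^k} θ(⟨x₀ + te_μ, μ⟩)`**, `x₀ = cornerIter k c₋` the lowest corner of the unit bond `c ∈ T^{(j+k)}`,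
`μ = c.dir` (`j + k ≤ m + K`): the `k`-fold iterate of the `L`-bond contour sums (5.1.2) is the sum over the straight run of `L^k` bonds.
[cite: BalabanImbrieJaffe1985, (5.1.2) p.313] -/
theorem lineSumIter_eq_sum_runBond {j : ℕ} (θ : PBond P j → ℝ) : ∀ (k : ℕ), j + k ≤ P.m + P.K → ∀ c : PBond P (j + k),
    lineSumIter θ k c = ∑ t ∈ range (P.L ^ k), θ (runBond (cornerIter k c.src) c.dir t)
  | 0, _, c => by simp [runBond_src_dir_zero]
  | k + 1, hk, c => by
    rw [lineSumIter_succ, lineSumU]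
    have h : ∀ s ∈ range P.L, lineSumIter θ k (runBond (corner c.src) c.dir s) =
        ∑ t ∈ range (P.L ^ k), θ (runBond (cornerIter (k + 1) c.src) c.dir (s * P.L ^ k + t)) := by
      intro s _
      rw [lineSumIter_eq_sum_runBond θ k (by omega)]
      refine Finset.sum_congr rfl fun t _ => ?_
      rw [show (runBond (corner c.src) c.dir s).src = runSite (corner c.src) c.dir s from rfl,
        show (runBond (corner c.src) c.dir s).dir = c.dir from rfl, cornerIter_runSite k (by omega), runBond_runSite,
        cornerIter_succ]
    rw [Finset.sum_congr rfl h, pow_succ', sum_range_mul]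

/-! ## §3  The correction `T_kg` through the kernels of `H_j` and `C^{(j)}` -/

/-- kernel: a pairing through the matrix — `⟨u₁, Tu₂⟩ = Σ_{b,b′} u₁(b)·⟨e_b, Te_{b′}⟩·u₂(b′)` on the `T^{(j)}` bond space. [folklore] -/
private theorem inner_eq_sum_coord {ι : Type*} [Fintype ι] [DecidableEq ι] (T : EuclideanSpace ℝ ι →ₗ[ℝ] EuclideanSpace ℝ ι)
    (u₁ u₂ : EuclideanSpace ℝ ι) :
    ⟪u₁, T u₂⟫ = ∑ b, ∑ b', u₁ b * ⟪EuclideanSpace.single b (1 : ℝ), T (EuclideanSpace.single b' (1 : ℝ))⟫ * u₂ b' := by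
  have h1 : u₁ = ∑ b, u₁ b • EuclideanSpace.single b (1 : ℝ) := by
    simpa using (EuclideanSpace.basisFun ι ℝ).sum_repr u₁ |>.symm
  have h2 : u₂ = ∑ b, u₂ b • EuclideanSpace.single b (1 : ℝ) := by
    simpa using (EuclideanSpace.basisFun ι ℝ).sum_repr u₂ |>.symm
  conv_lhs => rw [h1, h2]
  rw [map_sum, sum_inner]
  refine Finset.sum_congr rfl fun b _ => ?_
  rw [inner_sum]
  refine Finset.sum_congr rfl fun b' _ => ?_
  rw [map_smul, real_inner_smul_left, real_inner_smul_right]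
  ring

/-- **linearity of the correction in the unit-lattice plaquette function**: `(T_kg)(b) = Σ_p g(p)·(T_ke_p)(b)`.
[cite: BalabanImbrieJaffe1988, (5.4.1) p.281] -/
theorem TkF_eq_sum_single (hd : 2 ≤ P.d) (w η : ℝ) (k : ℕ) (g : TPlaq P k → ℝ) (b : PBond P 0) :
    TkF P hd w η k g b = ∑ p : TPlaq P k, g p * TkF P hd w η k (Pi.single p 1) b := by
  have hg : g = ∑ p : TPlaq P k, g p • (Pi.single p (1 : ℝ) : TPlaq P k → ℝ) := by
    funext q
    rw [Finset.sum_apply, Finset.sum_eq_single q]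
    · rw [Pi.smul_apply, Pi.single_eq_same, smul_eq_mul, mul_one]
    · intro p _ hp
      rw [Pi.smul_apply, Pi.single_eq_of_ne (Ne.symm hp), smul_zero]
    · intro hq; exact absurd (Finset.mem_univ q) hq
  conv_lhs => rw [hg]
  rw [map_sum, Finset.sum_apply]
  refine Finset.sum_congr rfl fun p _ => ?_
  rw [map_smul, Pi.smul_apply, smul_eq_mul]

/-- kernel: the basis vector of the η-bond space. [folklore] -/
private theorem toE_single' (b : PBond P 0) (a : ℝ) :
    toE P (Pi.single b a) = EuclideanSpace.single b a := rfl

/-- kernel: the basis vector of the `T^{(j)}` bond space. [folklore] -/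
private theorem toEj_single' {j : ℕ} (b : PBond P j) (a : ℝ) :
    toEj P j (Pi.single b a) = EuclideanSpace.single b a := rfl

/-- **(4.4.4) entrywise for the correction**: `(T_ke_p)(b) = Σ_{j<k} Σ_{b₁,b₂∈T^{(j)}} H_j(b, b₁)·C^{(j)}(b₁, b₂)·u^{(j)}_p(b₂)`,
`H_j(b, b₁) = (H_je_{b₁})(b)`, `C^{(j)}(b₁, b₂) = ⟨e_{b₁}, C^{(j)}e_{b₂}⟩`, `u^{(j)}_p = H_j*∂*Q^{e*}_ke_p` (weight `w`, lattice factor `η⁻¹`;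
p08's `adjoint_HkE_coord` evaluates `u^{(j)}_p` as edge averages of `∂^cH_je_{b₂}`). [cite: BalabanImbrieJaffe1985, (4.4.4) p.312] -/
theorem TkF_single_eq_sum (hd : 2 ≤ P.d) (w η : ℝ) (k : ℕ) (p : TPlaq P k) (b : PBond P 0) :
    TkF P hd w η k (Pi.single p 1) b = ∑ j ∈ Finset.range k, ∑ b₁ : PBond P j, ∑ b₂ : PBond P j,
      HkE P w η⁻¹ j (toEj P j (Pi.single b₁ 1)) b *
        ⟪toEj P j (Pi.single b₁ 1), CE P w η⁻¹ j (toEj P j (Pi.single b₂ 1))⟫ *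
        LinearMap.adjoint (HkE P w η⁻¹ j)
          (LinearMap.adjoint (curlOp (P := P) w η⁻¹) (QesOp (P := P) hd w k (toU P k (Pi.single p 1)))) b₂ := by
  set X : BondSpace P := LinearMap.adjoint (curlOp (P := P) w η⁻¹) (QesOp (P := P) hd w k (toU P k (Pi.single p 1))) with hX
  have h0 : TkF P hd w η k (Pi.single p 1) b = ⟪toE P (Pi.single b 1), DkE P w η⁻¹ k X⟫ := by
    rw [TkF_apply, toE_single' b, EuclideanSpace.inner_single_left, map_one, one_mul]
  rw [h0, inner_DkE_eq_sum]
  refine Finset.sum_congr rfl fun j _ => ?_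
  rw [inner_eq_sum_coord]
  refine Finset.sum_congr rfl fun b₁ _ => Finset.sum_congr rfl fun b₂ _ => ?_
  rw [adjoint_HkE_single_apply, ← toEj_single', ← toEj_single']

/-- **the correction through the kernels**: `(T_kg)(b) = Σ_p g(p) Σ_{j<k} Σ_{b₁,b₂} H_j(b,b₁)C^{(j)}(b₁,b₂)u^{(j)}_p(b₂)`.
[cite: BalabanImbrieJaffe1985, (4.5.4) p.313] -/
theorem TkF_eq_triple_sum (hd : 2 ≤ P.d) (w η : ℝ) (k : ℕ) (g : TPlaq P k → ℝ) (b : PBond P 0) :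
    TkF P hd w η k g b = ∑ p : TPlaq P k, g p * ∑ j ∈ Finset.range k, ∑ b₁ : PBond P j, ∑ b₂ : PBond P j,
      HkE P w η⁻¹ j (toEj P j (Pi.single b₁ 1)) b *
        ⟪toEj P j (Pi.single b₁ 1), CE P w η⁻¹ j (toEj P j (Pi.single b₂ 1))⟫ *
        LinearMap.adjoint (HkE P w η⁻¹ j)
          (LinearMap.adjoint (curlOp (P := P) w η⁻¹) (QesOp (P := P) hd w k (toU P k (Pi.single p 1)))) b₂ := by
  rw [TkF_eq_sum_single]
  exact Finset.sum_congr rfl fun p _ => by rw [TkF_single_eq_sum]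

/-- **the unit-bond line sum of the correction through the kernels** (`k ≤ m + K`): p11's `lineSumIter (T_kg) k c` is the sum over
the straight run `t < L^k` from the lowest corner of `c` of the triple kernel sum — the object a kernel-bound estimate of `K_T` starts from.
[cite: BalabanImbrieJaffe1985, (7.3.2) p.326] -/
theorem lineSumIter_TkF_eq (hd : 2 ≤ P.d) {k : ℕ} (hk : k ≤ P.m + P.K) (w η : ℝ) (g : TPlaq P k → ℝ)
    (c : PBond P (0 + k)) :
    lineSumIter (TkF P hd w η k g) k c = ∑ t ∈ range (P.L ^ k), ∑ p : TPlaq P k, g p *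
      ∑ j ∈ Finset.range k, ∑ b₁ : PBond P j, ∑ b₂ : PBond P j,
        HkE P w η⁻¹ j (toEj P j (Pi.single b₁ 1)) (runBond (cornerIter k c.src) c.dir t) *
          ⟪toEj P j (Pi.single b₁ 1), CE P w η⁻¹ j (toEj P j (Pi.single b₂ 1))⟫ *
          LinearMap.adjoint (HkE P w η⁻¹ j)
            (LinearMap.adjoint (curlOp (P := P) w η⁻¹) (QesOp (P := P) hd w k (toU P k (Pi.single p 1)))) b₂ := by
  rw [lineSumIter_eq_sum_runBond _ k (by omega) c]
  exact Finset.sum_congr rfl fun t _ => TkF_eq_triple_sum hd w η k g _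

end

end Literature.MathematicalPhysics.QuantumFieldTheory.BalabanImbrieJaffe1984to88.BIJ85LineSumTkKernel
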